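import Summits.AtomisticToContinuum.HydrodynamicLimit.Theses.InformationPercolationEngine

/-!
# Disproof of `KickFairRelEquilibriumMeso` (crux stmt-AtomisticToContinuum-15177, route
InformationPercolationEngine) — standing adversary file (cdisprove, cycle 1), findings:

* **D0 (typing; no junk escape, no cheap kill).** The decl elaborates (`W0.lean` rc 0, one sorry =
  the probe) and `kickFairRelEquilibriumMeso_iff` (§1) repackages it DEFINITIONALLY (`Iff.rfl`) into
  the three window conjuncts and `MesoBody rs` over the `r`-parametrised `let`-chain
  `kickSumRel`/`KickBoundRel` (verbatim; the rev-12 change is `r ↦ rs N` plus the `∃ rs` prefix and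
  nothing else). Inherited from the 14914 file (F0, re-read): flows exist at every `0 < σ < 1/2`
  (`nonempty_flow`), carry the true dynamics on a Liouville-conull measurable good set, `LG` and `G`
  are `liouville.withDensity` of POSITIVE densities on the hard-sphere domain (mutually absolutely
  continuous, so the `G`-a.e. ambiguity of the version `κ = condExp …` is `LG`-invisible), `LG(goodᶜ)
  = 0` (the `else` branches and `cnt` off `good` never enter `∫⁻ … dLG`), `κ` is Mathlib's genuine
  conditional expectation iff `z ↦ P z i n` is Borel (plumbing: good-set cut + joint measurability
  `HardSphereFlow.measurable_flow_prod_torus` + hitting times of closed sets by continuous orbits;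
  expected for EVERY `Φ`, unproved), the enumeration recycles past the last collision (14914 §5,
  landed as `Negative/EnumerationRecycling`). NEW: the 14914 negative file
  `KickFairRelEquilibriumFalseOfSubcellClusteringBias` no longer builds on the farm (its route decl
  `KickFairRelEquilibrium` left the Theses module at rev 12) — hence §1 re-declares the `let`-chain.
* **D1 (the window conjuncts, load-bearing analysis as theorems, §2–§5; LANDED verbatim as
  `Theorems/KickFairRelEquilibriumMeso/Negative/WindowAlgebra.lean`, p109023 @ 50f6353b1e9f — provers may
  import it for `kickFairRelEquilibriumMeso_iff.2 ⟨rs, …⟩`).** (i) `∀ N, 0 < rs N` is NOT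
  load-bearing: the lower edge forces it eventually and the crux is EQUIVALENT to its version without
  it (`kickFairRelEquilibriumMeso_iff_dropPos`; `mesoBody_congr`: the body reads only the tail of
  `rs`). (ii) The lower edge `(N+1)(rs N)³ → ∞` is EXACTLY `ε_N/rs N → 0` at one/every `σ > 0`
  (`lowerEdge_iff_tendsto_hsDiameter_div`) and gives `ℓ_N/rs N → 0` (`tendsto_freePath_div`): its
  whole content is non-pinning of impact vectors by coarse positions + intra-cell flights. It is an
  ANTI-TRIVIALITY clause for the consumer, not a truth condition: without it `rs N = ε_N/100` would be
  admissible and `κ ≈ g(X)` (positions finer than a diameter pin `ω` up to `rs/ε`), making the body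
  (morally) trivially TRUE. (iii) `rs → 0` kills every fixed-mesh mechanism of the lineage
  (`SubcellClusteringBiasPersists`: defect `∝ rs²`). (iv) `not_kickFairRelEquilibriumMeso_iff`: THE
  SHAPE OF ANY KILL — every admissible sequence must keep a defect; §6 types the corresponding
  `H`-template `WindowRobustKickBias` with the sorry-free reduction
  `kickFairRelEquilibriumMeso_false_of_windowRobustKickBias` (NOT filed `--negative-modulo`: no
  mechanism on file inhabits it, see D2, and a hold on a speculative `H` would be dishonest).
* **D2 (census of mechanisms in the window — why the decl resists).** Writing
  `Δ(P) := E_{LG}[g | P] − κ(P) = Cov_G(g(X), W | σ(P)) / E_G[W | σ(P)]`, `W = (dLG₀/dG) ∘ Φ_{−t}` the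
  backward weight (invariance of `G`), the sup over `|h| ≤ 1` makes the defect `≈ (ε/(N+1)) E_{LG} Σ |Δ|`,
  so a kill needs `E|Δ| ≠ o(1)` over `LG`-typical collisions along EVERY admissible `rs`.
  M1 sub-cell clustering (14914 F2): `∝ φ rs²|∇log ρ|² → 0`. M2 sub-cell hydrodynamic modes (14914
  F3): a speed-`N` LD LOWER bound under `G` — bites super-exponential stubs, never the decl. M3
  first-order gradients: `O(ε(1+|v|²)|∇|) → 0`. M4 Knudsen (ring/repeated-collision corrections to the
  pre-collisional pair law out of equilibrium): `O(ℓ|∇|) = O(Kn) → 0` at Euler scaling — consistent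
  with the MD literature on shear-induced pre-collisional correlations, which are `∝` shear rate
  (Lutsko 1996, doi:10.1103/physrevlett.77.2225: molecular chaos deviations in sheared hard spheres scale
  with the reduced shear rate, i.e. with `Kn`).
  M5 boundary layers `O(ℓ/rs)`, `O(ε/rs) → 0` (D1 ii). M6 POST-SHOCK horizons: the crux has `∀ τ`
  with no pre-shock restriction (its consumer `ChaosClosesEuler` only needs `[0, T)`); after the first
  shock of the data's Euler solution the evolved law carries `≍ N·ΔS` nats of fine-grained correlation
  relative to local equilibrium (conserved Shannon entropy vs produced hydrodynamic entropy), so every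
  entropy transfer is void there (memo M5) and fairness given the mesoscopic past becomes a genuinely
  new assertion — but the hidden information is, by every account in print, POST-collisional
  (un-shocking under velocity reversal), and no argument converts it into a bias of FORWARD kicks given
  a past; alive only as "no proof either way", no witness (Enskog theory with Enskog's chaos closure
  reproduces MD shock PROFILES of the dense hard-sphere gas, Frezzotti 1998,
  doi:10.1016/s0898-1221(97)00261-7 — evidence that pre-collisional chaos holds through shocks at the
  one-body level; nothing is known given a mesoscopic past). M7 packing/implosion (rattack A15): needs
  exact implosion from smooth data to survive the hs-EOS stiffening — three unproven links. M8 pinning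
  by the two global photos: subcritical (`≈ N/2` resolved kicks, `< 1.5N`; mesoscopic cells change the
  count not at all). M9 equilibrium half (a): `Var_G S_h → 0` needs only `o(1)` average covariance
  between unrelated collision terms; no slow global positional mode at low density. M10 the flight
  times in the past: survival factors are common to both laws given `P` up to `O(rs|∇|)`. VERDICT: no
  mechanism on file survives the window; F1 of 14914 stands (every unconditional `¬` needs a LOWER
  bound on a collision statistic of the deterministic `N`-body flow — none in the tree), so this cycle
  lands window algebra, not a kill.
* **D3 (hypothesis census beyond the window).** `|h| ≤ 1`, bounded `g`, the good-set cut, `0 < δ`,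
  `0 < τ` are load-bearing exactly as in 14914 F4 and none is landable as `_false_without_` (F1).
  NEW on the cut: the structure `HardSphereFlow` leaves `flow` arbitrary off `good` subject only to
  each time-slice `flow t` being measurable and Liouville-preserving; on the Liouville-NULL overlap
  region `Dᶜ` one may plant orbits `t ↦ (c⋆ if t = f z, c₀ else)` with `f` a non-measurable INJECTION
  — every slice differs from a constant on at most one point (measurable), yet `z ↦ nthCollisionTimeOf
  i 0 z = f z` there: WITHOUT the cut `P` would be non-measurable for such an admissible `Φ`, `comap P
  ≰ Borel`, `κ ≡ 0` and the ABSOLUTE form returns (false already by `g ≡ 1` modulo collision-rate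
  positivity). So the cut is load-bearing against junk the `∀ Φ` genuinely admits, not only against
  hypothetical junk. `σ < σ₀`: immaterial to every mechanism of D2 (all `∝ σ³`, present at every `σ`).
  `Continuous g`: measurable bounded would do. `∃ rs` BEFORE `∀ profiles ∀ σ ∀ τ`: stronger than the
  consumer needs (`∀ … ∃ rs` would serve `PercolationClosesChaos` equally) but harmless against every
  known constraint — the lower edge is `σ`-free (D1 ii) and the heuristic upper edge
  `rs ≪ (ℓ v̄ τ)^{1/2} ≍ N^{-1/6}√τ/σ` is met eventually by `(N+1)^{-1/4}` at every fixed `(σ, τ)`.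
* **D4 (targets preview — no line is registered; the one idea on file is `two-time-pinch`,
  `Cruxes/KickFairRelEquilibriumMeso/TwoTimePinchSketch.lean`).** L2 `condEntropy_ineq` checked TRUE
  on paper in full generality (tilt `ν` by `e^f/ν[e^f|σ(π)]`, which keeps the `π`-marginal, then data
  processing; the `μ`-integrability of `log ν[e^f|σ(π)]` follows from the hypotheses by two fibrewise
  Fenchel inequalities, so no Bochner junk) — not a target. S0 `StaticCellBill` plausible (fibre KL
  `O(L² rs²)` per particle at every mesh for Lipschitz profiles; first order centred). R1 `RestartBias`
  AS TYPED is STRONGER THAN THE CRUX'S NON-EQUILIBRIUM HALF: `∀ M ≥ 0 … ∀ U₀ U` measurable with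
  `G(A) ≥ e^{-M(N+1)}` admits EVERY backward bin of large-deviation rate `< M` at EVERY `σ < 1/2` — not
  only `LG`-typical time-zero data of smooth dilute profiles but violently non-equilibrium cheap
  preparations (radially imploding momentum patterns, counterflows at mesh scale, pre-compressed
  shells: rate `O(c²)` or `O(f_ex)` per particle), whose forward evolution at `t_s` is an arbitrary
  `G`-cheap non-equilibrium ensemble; R1 then asserts `κ`-fairness of kicks for ALL of them (a
  Boltzmann hypothesis for every cheap preparation, including dynamically jammed cores at `σ` near
  `1/2`, where the equilibrium kernel given dense cells is crystalline and the evolved one amorphous).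
  Recommended before registration (for the lead, not a kill): restrict `U₀` to bins of the time-zero
  cell data that are TYPICAL for `LG` with continuous positive profiles, and `σ < σ₀(profiles)`; keep
  `U` (slot-start data is `P`-measurable up to the `O(ℓ/rs)` boundary layer, D1 ii). With `U₀ = U =
  univ`, R1 reduces to exact centring (`E_G Z = 0` modulo the recycling-cut nullity, 14914 §5).
  Typing note for S0/R1/R2: they silently need `Measurable (cellData r)` (true — finite cards and
  sums over `Torus.measurable_coarseCell` fibres — but unstated): were it non-measurable,
  `Measure.map` would be the zero measure, `klDiv 0 0 = 0`, and S0 would assert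
  `KL(LG‖G) = I₀(N+1)(1+o(1)) ≤ C(N+1)rs_N²`, false as `rs → 0`; prove measurability first.
* **D5 (dead ends, so nobody repeats them).** Everything in 14914 F5; importing the 14914 negative
  file (unbuildable since rev 12); a kill through `∃ rs ∀ σ` quantifier order (D3); `coarseCell r` for
  `r ≥ 1/2` is the sign-octant map, never constant (irrelevant as `rs → 0`); monotonicity of the body
  in the mesh (conditioning on a finer past changes `κ`, no order relation between `E_{LG}|S_h|` at two
  meshes); MD (the window is visible only for `N ≳ 10⁹`; `κ` not computable).
-/

open MeasureTheory Metric Real Set Filter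
open scoped InnerProductSpace ENNReal BigOperators Classical Topology

namespace Summit.AtomisticToContinuum.HydrodynamicLimit.Cruxes.KickFairRelEquilibriumMeso.Disproof

noncomputable section

open Literature.MathematicalPhysics.KineticTheory (T3 V3 hsDiameter localGibbsLaw)
open Literature.Analysis.FluidPDE (HardSphereFlow Config collisionTimesOf flightStart Geometry)
open Summit.AtomisticToContinuum.HydrodynamicLimit.Theses.InformationPercolationEngine
  (KickFairRelEquilibriumMeso)
/-- The 13478 typed past: cells and exact velocities of all spheres at the two flight starts, and
the partner label (same TYPE at every mesh; identical to `KickIsotropyInfoNegative.Past`, inlined to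
keep this file's imports to the route file alone). -/
abbrev Past (N : ℕ) : Type :=
  ((Fin (N + 1) → (Fin 3 → ℤ) × V3) × (Fin (N + 1) → (Fin 3 → ℤ) × V3)) × Fin (N + 1)

/-- The flow type of the crux at reduced density `σ` and size `N + 1` (identical to
`KickIsotropyInfoNegative.Flow`). -/
abbrev Flow (σ : ℝ) (N : ℕ) : Type :=
  HardSphereFlow (Literature.Analysis.FluidPDE.Torus.geometry (Fin 3)) (hsDiameter σ N) (N + 1)

/-! ## §1 The crux, repackaged (definitionally) -/

/-- The typed coarse past: cells and exact velocities of all spheres at the two flight starts,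
partner label, the three times `(s_i, s_q, t_{i,n})` (same TYPE at every mesh). -/
abbrev PastRel (N : ℕ) : Type := Past N × (ℝ × ℝ × ℝ)

/-- The compensated (equilibrium-centred) kick sum `S_h` at mesh `r` — the crux's `let`-chain
verbatim with `rs N` abstracted to `r` (textually the 14914 `kickSumRel`). -/
def kickSumRel (σ : ℝ) (N : ℕ) (Φ : Flow σ N) (τ r : ℝ) (g : V3 × V3 × V3 → ℝ)
    (h : Fin (N + 1) → ℕ → PastRel N → ℝ) (z : Config (N + 1) (Fin 3) T3) : ℝ :=
  let ε := hsDiameter σ N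
  let G : Geometry (Fin 3) T3 := Literature.Analysis.FluidPDE.Torus.geometry (Fin 3)
  let q : T3 → (Fin 3 → ℤ) := Literature.Analysis.FluidPDE.Torus.coarseCell r
  let γ : Config (N + 1) (Fin 3) T3 → ℝ → Config (N + 1) (Fin 3) T3 := fun z s => Φ.flow s z
  let cnt : Config (N + 1) (Fin 3) T3 → Fin (N + 1) → ℕ := fun z i =>
    Set.ncard (collisionTimesOf G ε (γ z) i ∩ Set.Ioc 0 τ)
  let P : Config (N + 1) (Fin 3) T3 → Fin (N + 1) → ℕ →
      (((Fin (N + 1) → (Fin 3 → ℤ) × V3) × (Fin (N + 1) → (Fin 3 → ℤ) × V3)) × Fin (N + 1)) ×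
        (ℝ × ℝ × ℝ) := fun z i n =>
    if z ∈ Φ.good then
      ((Φ.coarsePastOf q i n z, Φ.nthPartnerOf i n z),
        (flightStart G ε (γ z) 0 i (Φ.nthCollisionTimeOf i n z),
          flightStart G ε (γ z) 0 (Φ.nthPartnerOf i n z) (Φ.nthCollisionTimeOf i n z),
          Φ.nthCollisionTimeOf i n z))
    else (((fun _ => (0, 0), fun _ => (0, 0)), 0), (0, 0, 0))
  let X : Fin (N + 1) → ℕ → Config (N + 1) (Fin 3) T3 → V3 × V3 × V3 := fun i n z =>
    if z ∈ Φ.good then ((Φ.nthRecordOf i n z).impactVec, (Φ.nthRecordOf i n z).preVel) else 0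
  let κ : Fin (N + 1) → ℕ → Config (N + 1) (Fin 3) T3 → ℝ := fun i n =>
    MeasureTheory.condExp (MeasurableSpace.comap (fun z => P z i n) inferInstance)
      (localGibbsLaw σ (fun _ => 1) (fun _ => 0) (fun _ => 1) N Φ) (fun z => g (X i n z))
  ε / (N + 1 : ℝ) * ∑ i : Fin (N + 1), ∑ n ∈ Finset.range (cnt z i),
    h i n (P z i n) * (g (X i n z) - κ i n z)

/-- The conclusion of the crux for given data at mesh `r`: `‖S_h‖_{L¹(local Gibbs law)} ≤ δ`. -/
def KickBoundRel (σ : ℝ) (a₀ θ₀ : T3 → ℝ) (u₀ : T3 → V3) (N : ℕ) (Φ : Flow σ N) (τ r : ℝ)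
    (g : V3 × V3 × V3 → ℝ) (h : Fin (N + 1) → ℕ → PastRel N → ℝ) (δ : ℝ) : Prop :=
  ∫⁻ z, ENNReal.ofReal |kickSumRel σ N Φ τ r g h z| ∂(localGibbsLaw σ a₀ u₀ θ₀ N Φ) ≤
    ENNReal.ofReal δ

/-- **The body of the crux along a cell sequence `rs`** (everything after the three window
conjuncts): for continuous positive profiles, `∃ σ₀ ∀ σ < σ₀ ∀ Φ ∀ τ ∀ g ∀ δ ∃ N₀ ∀ N ≥ N₀ ∀ h`,
`KickBoundRel … (rs N) …`. -/
def MesoBody (rs : ℕ → ℝ) : Prop :=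
  ∀ (a₀ θ₀ : T3 → ℝ) (u₀ : T3 → V3), Continuous a₀ → Continuous θ₀ → Continuous u₀ →
    (∀ x, 0 < a₀ x) → (∀ x, 0 < θ₀ x) → ∃ σ₀ : ℝ, 0 < σ₀ ∧ ∀ σ : ℝ, 0 < σ → σ < σ₀ →
    ∀ Φ : (N : ℕ) → Flow σ N, ∀ τ : ℝ, 0 < τ →
    ∀ g : V3 × V3 × V3 → ℝ, Continuous g → (∃ C : ℝ, ∀ p, |g p| ≤ C) →
    ∀ δ : ℝ, 0 < δ → ∃ N₀ : ℕ, ∀ N : ℕ, N₀ ≤ N →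
    ∀ h : Fin (N + 1) → ℕ → PastRel N → ℝ, (∀ i n, Measurable (h i n)) →
    (∀ i n p, |h i n p| ≤ 1) → KickBoundRel σ a₀ θ₀ u₀ N (Φ N) τ (rs N) g h δ

/-- **The lower window edge** `(N+1)·(rs N)³ → +∞` (particles per cell diverge). -/
def LowerEdge (rs : ℕ → ℝ) : Prop :=
  Tendsto (fun N : ℕ => ((N : ℝ) + 1) * rs N ^ 3) atTop atTop

/-- **Faithful restatement of the crux** (definitional unfolding): window conjuncts, then
`MesoBody`. -/
theorem kickFairRelEquilibriumMeso_iff :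
    KickFairRelEquilibriumMeso ↔
      ∃ rs : ℕ → ℝ, (∀ N, 0 < rs N) ∧ Tendsto rs atTop (𝓝 0) ∧ LowerEdge rs ∧ MesoBody rs :=
  Iff.rfl

/-! ## §2 Only the tail of the sequence is read -/

/-- **`MesoBody` depends on the cell sequence only through its tail**: sequences that eventually
agree have the same body (the `∃ N₀ ∀ N ≥ N₀` absorbs any finite prefix). [folklore] -/
theorem mesoBody_congr {rs rs' : ℕ → ℝ} (heq : rs =ᶠ[atTop] rs') : MesoBody rs ↔ MesoBody rs' := by
  -- symmetric argument, done once
  suffices key : ∀ {a b : ℕ → ℝ}, a =ᶠ[atTop] b → MesoBody a → MesoBody b from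
    ⟨key heq, key heq.symm⟩
  intro a b hab hA a₀ θ₀ u₀ ha hθ hu ha0 hθ0
  obtain ⟨σ₀, hσ₀, H⟩ := hA a₀ θ₀ u₀ ha hθ hu ha0 hθ0
  refine ⟨σ₀, hσ₀, fun σ hσ hσσ₀ Φ τ hτ g hg hgb δ hδ => ?_⟩
  obtain ⟨N₀, hN₀⟩ := H σ hσ hσσ₀ Φ τ hτ g hg hgb δ hδ
  obtain ⟨N₁, hN₁⟩ := eventually_atTop.1 hab
  refine ⟨max N₀ N₁, fun N hN h hhm hhb => ?_⟩
  have h1 : a N = b N := hN₁ N (le_of_max_le_right hN)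
  rw [← h1]
  exact hN₀ N (le_of_max_le_left hN) h hhm hhb

/-! ## §3 The positivity conjunct is not load-bearing -/

/-- **The lower edge forces positivity eventually**: `(N+1)(rs N)³ → +∞ ⇒ 0 < rs N` for all large
`N` (a cube is positive iff its base is). [folklore] -/
theorem eventually_pos_of_lowerEdge {rs : ℕ → ℝ} (h3 : LowerEdge rs) : ∀ᶠ N in atTop, 0 < rs N := by
  filter_upwards [h3.eventually_gt_atTop 0] with N hN
  have h1 : (0 : ℝ) < (N : ℝ) + 1 := by positivity
  have h2 : 0 < rs N ^ 3 := by
    by_contra hle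
    push Not at hle
    have := mul_nonpos_of_nonneg_of_nonpos h1.le hle
    linarith
  exact (Odd.pow_pos_iff (by decide : Odd 3)).1 h2

/-- **The crux is equivalent to its version WITHOUT `∀ N, 0 < rs N`.** Given a sequence with the
two limit conjuncts and the body, replace its (finitely many) non-positive cells by `1`: the limits
and — by `mesoBody_congr` — the body are unchanged. So a prover may ignore positivity and a
refuter gains nothing from it. [folklore] -/
theorem kickFairRelEquilibriumMeso_iff_dropPos :
    KickFairRelEquilibriumMeso ↔
      ∃ rs : ℕ → ℝ, Tendsto rs atTop (𝓝 0) ∧ LowerEdge rs ∧ MesoBody rs := by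
  rw [kickFairRelEquilibriumMeso_iff]
  constructor
  · rintro ⟨rs, -, h0, h3, hB⟩
    exact ⟨rs, h0, h3, hB⟩
  · rintro ⟨rs, h0, h3, hB⟩
    set rs' : ℕ → ℝ := fun N => if 0 < rs N then rs N else 1 with hrs'
    have heq : rs =ᶠ[atTop] rs' := by
      filter_upwards [eventually_pos_of_lowerEdge h3] with N hN
      simp [hrs', hN]
    refine ⟨rs', fun N => ?_, h0.congr' heq, ?_, (mesoBody_congr heq).1 hB⟩
    · simp only [hrs']
      split_ifs with h
      · exact h
      · exact one_pos
    · refine Tendsto.congr' ?_ h3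
      filter_upwards [heq] with N hN
      rw [hN]

/-! ## §4 What the lower edge says, exactly: `ε ≪ rs` (and hence `ℓ ≪ rs`) -/

/-- The algebra of the reduced diameter against a mesh: `ε_N / r = σ · ((N+1) r³)^{-1/3}` for
`r > 0`. [folklore] -/
theorem hsDiameter_div_eq (σ : ℝ) (N : ℕ) {r : ℝ} (hr : 0 < r) :
    hsDiameter σ N / r = σ * (((N : ℝ) + 1) * r ^ 3) ^ (-(1 / 3 : ℝ)) := by
  have hN : (0 : ℝ) < (N : ℝ) + 1 := by positivity
  unfold hsDiameter
  rw [Real.mul_rpow hN.le (pow_nonneg hr.le 3), Real.rpow_neg hN.le, Real.rpow_neg (pow_nonneg hr.le 3),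
    show (r ^ 3 : ℝ) = r ^ (3 : ℝ) by norm_cast, ← Real.rpow_mul hr.le]
  norm_num
  rw [Real.rpow_neg hN.le]
  field_simp

/-- **Lower edge ⇒ no geometric pinning**: along a positive sequence with `(N+1)(rs N)³ → ∞`,
`ε_N / rs N → 0` at every `σ` — the cells become infinitely coarser than a diameter. [folklore] -/
theorem tendsto_hsDiameter_div {rs : ℕ → ℝ} (σ : ℝ) (hpos : ∀ N, 0 < rs N) (h3 : LowerEdge rs) :
    Tendsto (fun N : ℕ => hsDiameter σ N / rs N) atTop (𝓝 0) := by
  simp_rw [fun N => hsDiameter_div_eq σ N (hpos N)]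
  rw [show (0 : ℝ) = σ * 0 by ring]
  exact ((tendsto_rpow_neg_atTop (by norm_num : (0 : ℝ) < 1 / 3)).comp h3).const_mul σ

/-- **Conversely, `ε_N / rs N → 0` at one `σ > 0` gives back the lower edge**: the third window
conjunct carries no information beyond "`ε ≪ rs`". [folklore] -/
theorem lowerEdge_of_tendsto_hsDiameter_div {rs : ℕ → ℝ} {σ : ℝ} (hσ : 0 < σ) (hpos : ∀ N, 0 < rs N)
    (h : Tendsto (fun N : ℕ => hsDiameter σ N / rs N) atTop (𝓝 0)) : LowerEdge rs := by
  -- y_N := (N+1) rs³ > 0 and σ y_N^{-1/3} → 0, so y_N^{-1/3} → 0⁺, so y_N = (y_N^{-1/3})^{-3} → ∞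
  have hy : ∀ N : ℕ, 0 < ((N : ℝ) + 1) * rs N ^ 3 := fun N =>
    mul_pos (by positivity) (pow_pos (hpos N) 3)
  have h1 : Tendsto (fun N : ℕ => (((N : ℝ) + 1) * rs N ^ 3) ^ (-(1 / 3 : ℝ))) atTop (𝓝 0) := by
    have h' : Tendsto (fun N : ℕ => σ⁻¹ * (hsDiameter σ N / rs N)) atTop (𝓝 (σ⁻¹ * 0)) :=
      h.const_mul σ⁻¹
    rw [mul_zero] at h'
    refine h'.congr fun N => ?_
    rw [hsDiameter_div_eq σ N (hpos N), ← mul_assoc, inv_mul_cancel₀ hσ.ne', one_mul]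
  have h2 : Tendsto (fun N : ℕ => (((N : ℝ) + 1) * rs N ^ 3) ^ (-(1 / 3 : ℝ))) atTop (𝓝[>] 0) := by
    refine tendsto_nhdsWithin_iff.2 ⟨h1, Eventually.of_forall fun N => ?_⟩
    exact Real.rpow_pos_of_pos (hy N) _
  have h3 : Tendsto (fun x : ℝ => x ^ (-(3 : ℝ))) (𝓝[>] 0) atTop := tendsto_rpow_neg_nhdsGT_zero (by norm_num)
  refine (h3.comp h2).congr fun N => ?_
  simp only [Function.comp]
  rw [← Real.rpow_mul (hy N).le]
  norm_num

/-- **The lower edge, as an equivalence** (`σ > 0`, positive cells): `(N+1)(rs N)³ → ∞ ⟺ ε_N/rs N → 0`.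
[folklore] -/
theorem lowerEdge_iff_tendsto_hsDiameter_div {rs : ℕ → ℝ} {σ : ℝ} (hσ : 0 < σ) (hpos : ∀ N, 0 < rs N) :
    LowerEdge rs ↔ Tendsto (fun N : ℕ => hsDiameter σ N / rs N) atTop (𝓝 0) :=
  ⟨tendsto_hsDiameter_div σ hpos, lowerEdge_of_tendsto_hsDiameter_div hσ hpos⟩

/-- The mean free path at unit number density: `ℓ_N = 1/(π (N+1) ε_N²) = ε_N/(π σ³)`
(Boltzmann–Enskog free path without the contact-value factor). -/
def freePath (σ : ℝ) (N : ℕ) : ℝ := hsDiameter σ N / (Real.pi * σ ^ 3)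

/-- **Lower edge ⇒ flights are intra-cell**: `ℓ_N / rs N → 0` along every admissible sequence at
every `σ > 0` — the boundary-layer discrepancies `O(ℓ/rs)` of the lineage die in the window.
[folklore] -/
theorem tendsto_freePath_div {rs : ℕ → ℝ} {σ : ℝ} (hpos : ∀ N, 0 < rs N) (h3 : LowerEdge rs) :
    Tendsto (fun N : ℕ => freePath σ N / rs N) atTop (𝓝 0) := by
  have key : ∀ N : ℕ, freePath σ N / rs N = (Real.pi * σ ^ 3)⁻¹ * (hsDiameter σ N / rs N) := by
    intro N
    unfold freePath
    rw [div_div, mul_comm (Real.pi * σ ^ 3) (rs N), ← div_div, div_eq_inv_mul _ (Real.pi * σ ^ 3)]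
  simp_rw [key]
  rw [show (0 : ℝ) = (Real.pi * σ ^ 3)⁻¹ * 0 by ring]
  exact (tendsto_hsDiameter_div σ hpos h3).const_mul _

/-! ## §5 The shape of any kill -/

/-- **`¬ KickFairRelEquilibriumMeso` iff EVERY admissible sequence keeps a defect.** A refutation, or
a negative lemma modulo `H`, must therefore name a kick-law defect that survives `rs → 0` together
with `ε/rs → 0` (equivalently `ℓ/rs → 0`): scale artefacts of one mesh no longer refute. [folklore] -/
theorem not_kickFairRelEquilibriumMeso_iff :
    ¬ KickFairRelEquilibriumMeso ↔
      ∀ rs : ℕ → ℝ, (∀ N, 0 < rs N) → Tendsto rs atTop (𝓝 0) → LowerEdge rs → ¬ MesoBody rs := by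
  rw [kickFairRelEquilibriumMeso_iff]
  simp only [not_exists, not_and]

/-- **Equivalently (positivity dropped)**: every sequence with `rs → 0` and `ε/rs → 0` keeps a
defect. [folklore] -/
theorem not_kickFairRelEquilibriumMeso_iff' :
    ¬ KickFairRelEquilibriumMeso ↔
      ∀ rs : ℕ → ℝ, Tendsto rs atTop (𝓝 0) → LowerEdge rs → ¬ MesoBody rs := by
  rw [kickFairRelEquilibriumMeso_iff_dropPos]
  simp only [not_exists, not_and]

/-! ## §6 The `H`-template of any kill in the window (sorry-free reduction; NOT filed as a hold) -/

/-- **`H`-template: a window-robust kick bias for the data `(a₀, g)`** (`θ₀ ≡ 1`, `u₀ ≡ 0`): along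
EVERY admissible cell sequence, for every `σ₀` there are `σ < σ₀`, a flow family, a horizon `τ` and
`δ > 0` such that for infinitely many `N` SOME admissible weight keeps `E_{LG}|S_h| > δ` at mesh
`rs N`. By `not_kickFairRelEquilibriumMeso_iff` every refutation of the crux factors through an
instance of this shape (possibly with other `θ₀, u₀`). CENSUS (module docstring D2): no mechanism on
file inhabits it — M1–M5 vanish along every admissible sequence, M6 (post-shock hidden entropy) and
M7 (implosion/packing) have no witness in print. Recorded so that the next disprover cycle, a
triager or a planner can see at a glance what a kill must produce: a defect surviving `rs → 0` AND
`ε/rs → 0` simultaneously. [topic MathematicalPhysics/KineticTheory] -/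
def WindowRobustKickBias (a₀ : T3 → ℝ) (g : V3 × V3 × V3 → ℝ) : Prop :=
  ∀ rs : ℕ → ℝ, (∀ N, 0 < rs N) → Tendsto rs atTop (𝓝 0) → LowerEdge rs →
    ∀ σ₀ : ℝ, 0 < σ₀ → ∃ σ : ℝ, 0 < σ ∧ σ < σ₀ ∧ ∃ Φ : (N : ℕ) → Flow σ N, ∃ τ : ℝ, 0 < τ ∧
      ∃ δ : ℝ, 0 < δ ∧ ∀ N₀ : ℕ, ∃ N : ℕ, N₀ ≤ N ∧
        ∃ h : Fin (N + 1) → ℕ → PastRel N → ℝ, (∀ i n, Measurable (h i n)) ∧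
          (∀ i n p, |h i n p| ≤ 1) ∧
          ¬ KickBoundRel σ a₀ (fun _ => 1) (fun _ => 0) N (Φ N) τ (rs N) g h δ

/-- **Reduction: a window-robust kick bias for admissible data refutes the crux** (sorry-free; the
data must be a continuous positive activity and a continuous bounded kick test, e.g. the lineage's
`tiltedActivity` / `zonalTest`). Not filed `--negative-modulo`: `H` is a template, not a mechanism. -/
theorem kickFairRelEquilibriumMeso_false_of_windowRobustKickBias {a₀ : T3 → ℝ}
    {g : V3 × V3 × V3 → ℝ} (ha : Continuous a₀) (ha0 : ∀ x, 0 < a₀ x) (hg : Continuous g)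
    (hgb : ∃ C : ℝ, ∀ p, |g p| ≤ C) (H : WindowRobustKickBias a₀ g) :
    ¬ KickFairRelEquilibriumMeso := by
  rw [not_kickFairRelEquilibriumMeso_iff]
  intro rs hpos h0 h3 hB
  obtain ⟨σ₀, hσ₀, hall⟩ := hB a₀ (fun _ => 1) (fun _ => 0) ha continuous_const continuous_const
    ha0 (fun _ => one_pos)
  obtain ⟨σ, hσ, hσσ₀, Φ, τ, hτ, δ, hδ, hN⟩ := H rs hpos h0 h3 σ₀ hσ₀
  obtain ⟨N₀, hN₀⟩ := hall σ hσ hσσ₀ Φ τ hτ g hg hgb δ hδ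
  obtain ⟨N, hle, h, hhm, hhb, hnot⟩ := hN N₀
  exact hnot (hN₀ N hle h hhm hhb)

/-! ## §7 The two limit conjuncts only CONSTRAIN the prover's witness (monotonicity remarks) -/

/-- The crux WITHOUT the lower edge (finer-than-diameter cells admissible: the pinning regime). -/
def MesoWithoutLowerEdge : Prop :=
  ∃ rs : ℕ → ℝ, (∀ N, 0 < rs N) ∧ Tendsto rs atTop (𝓝 0) ∧ MesoBody rs

/-- The crux WITHOUT `rs → 0` (macroscopic cells admissible: the fixed-mesh regime of 14914). -/
def MesoWithoutVanishing : Prop :=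
  ∃ rs : ℕ → ℝ, (∀ N, 0 < rs N) ∧ LowerEdge rs ∧ MesoBody rs

/-- Dropping the lower edge WEAKENS the crux (so no `_false_without_lowerEdge` can exist unless the
crux itself is false): the edge is an anti-triviality clause for the consumer `PercolationClosesChaos`,
which must run on whatever sequence the `∃` delivers. [folklore] -/
theorem mesoWithoutLowerEdge_of (hK : KickFairRelEquilibriumMeso) : MesoWithoutLowerEdge := by
  obtain ⟨rs, hpos, h0, -, hB⟩ := kickFairRelEquilibriumMeso_iff.1 hK
  exact ⟨rs, hpos, h0, hB⟩

/-- Dropping `rs → 0` WEAKENS the crux likewise; the fixed-mesh negative lemma of 14914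
(`SubcellClusteringBiasPersists`, defect `∝ r²` at ONE mesh `r`) does not even refute THIS weakening
(it would need the bias at every mesh bounded below along the sequence). [folklore] -/
theorem mesoWithoutVanishing_of (hK : KickFairRelEquilibriumMeso) : MesoWithoutVanishing := by
  obtain ⟨rs, hpos, -, h3, hB⟩ := kickFairRelEquilibriumMeso_iff.1 hK
  exact ⟨rs, hpos, h3, hB⟩

/-- **The default witness lives in the window**: `rs N = (N+1)^{-1/4}` is positive, tends to `0`, and
has `(N+1)·rs³ = (N+1)^{1/4} → ∞` (particles per cell diverge like `N^{1/4}`; `ε/rs = σ(N+1)^{-1/12}`,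
slow: a factor `3.2` at `N = 10⁶`). [folklore] -/
theorem quarter_admissible :
    (∀ N : ℕ, 0 < ((N : ℝ) + 1) ^ (-(1 / 4 : ℝ))) ∧
      Tendsto (fun N : ℕ => ((N : ℝ) + 1) ^ (-(1 / 4 : ℝ))) atTop (𝓝 0) ∧
      LowerEdge fun N : ℕ => ((N : ℝ) + 1) ^ (-(1 / 4 : ℝ)) := by
  have hN1 : Tendsto (fun N : ℕ => (N : ℝ) + 1) atTop atTop :=
    tendsto_atTop_add_const_right _ 1 tendsto_natCast_atTop_atTop
  refine ⟨fun N => by positivity, (tendsto_rpow_neg_atTop (by norm_num : (0 : ℝ) < 1 / 4)).comp hN1, ?_⟩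
  have key : ∀ N : ℕ, ((N : ℝ) + 1) * (((N : ℝ) + 1) ^ (-(1 / 4 : ℝ))) ^ 3 = ((N : ℝ) + 1) ^ (1 / 4 : ℝ) := by
    intro N
    have hN : (0 : ℝ) < (N : ℝ) + 1 := by positivity
    rw [← Real.rpow_natCast, ← Real.rpow_mul hN.le]
    conv_lhs => rw [show ((N : ℝ) + 1) = ((N : ℝ) + 1) ^ (1 : ℝ) by rw [Real.rpow_one]]
    rw [← Real.rpow_mul hN.le, ← Real.rpow_add hN]
    norm_num
  unfold LowerEdge
  simp_rw [key]
  exact (tendsto_rpow_atTop (by norm_num : (0 : ℝ) < 1 / 4)).comp hN1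

/-! ## §8 Quantifier order: the crux picks ONE sequence before the profiles, `σ` and `τ` -/

/-- The body of the crux for FIXED profiles along `rs` (the tail of `MesoBody` after the profile
binders). -/
def MesoBodyAt (rs : ℕ → ℝ) (a₀ θ₀ : T3 → ℝ) (u₀ : T3 → V3) : Prop :=
  ∃ σ₀ : ℝ, 0 < σ₀ ∧ ∀ σ : ℝ, 0 < σ → σ < σ₀ →
    ∀ Φ : (N : ℕ) → Flow σ N, ∀ τ : ℝ, 0 < τ →
    ∀ g : V3 × V3 × V3 → ℝ, Continuous g → (∃ C : ℝ, ∀ p, |g p| ≤ C) →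
    ∀ δ : ℝ, 0 < δ → ∃ N₀ : ℕ, ∀ N : ℕ, N₀ ≤ N →
    ∀ h : Fin (N + 1) → ℕ → PastRel N → ℝ, (∀ i n, Measurable (h i n)) →
    (∀ i n p, |h i n p| ≤ 1) → KickBoundRel σ a₀ θ₀ u₀ N (Φ N) τ (rs N) g h δ

/-- **The profilewise (`∀ profiles ∃ rs`) variant** — what the consumer `PercolationClosesChaos`
actually needs (it fixes the profiles first and runs on whatever admissible sequence it is handed). -/
def MesoProfilewise : Prop :=
  ∀ (a₀ θ₀ : T3 → ℝ) (u₀ : T3 → V3), Continuous a₀ → Continuous θ₀ → Continuous u₀ →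
    (∀ x, 0 < a₀ x) → (∀ x, 0 < θ₀ x) →
    ∃ rs : ℕ → ℝ, (∀ N, 0 < rs N) ∧ Tendsto rs atTop (𝓝 0) ∧ LowerEdge rs ∧ MesoBodyAt rs a₀ θ₀ u₀

/-- **The crux is the STRONGER quantifier order** (`∃ rs ∀ profiles ⇒ ∀ profiles ∃ rs`); the
converse is not formal (a diagonal sequence need not exist). Harmless against every known
constraint (D3: the lower edge is `σ`-free and `(N+1)^{-1/4}` meets the heuristic upper edge
`N^{-1/6}√τ/σ` eventually at every fixed `(σ, τ)`), recorded because a refutation exploiting the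
order — a family of profiles whose admissible windows have EMPTY intersection — would be classed
misstated with `MesoProfilewise` as the repair. [folklore] -/
theorem mesoProfilewise_of (hK : KickFairRelEquilibriumMeso) : MesoProfilewise := by
  obtain ⟨rs, hpos, h0, h3, hB⟩ := kickFairRelEquilibriumMeso_iff.1 hK
  intro a₀ θ₀ u₀ ha hθ hu ha0 hθ0
  exact ⟨rs, hpos, h0, h3, hB a₀ θ₀ u₀ ha hθ hu ha0 hθ0⟩

end

end Summit.AtomisticToContinuum.HydrodynamicLimit.Cruxes.KickFairRelEquilibriumMeso.Disproof
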